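import Summits.AnomalousDissipation.AnomalousDissipation.Theorems.SolenoidalFractalHomogenisationRealisedQuasiStaticCellLawSlavedSectorDecayAE
import Summits.AnomalousDissipation.AnomalousDissipation.Theorems.SolenoidalFractalHomogenisationRealisedQuasiStaticCellLawAnySlotInputs
import Summits.AnomalousDissipation.AnomalousDissipation.Theorems.SolenoidalFractalHomogenisationRealisedQuasiStaticCellLawWeakArithmetic
import Summits.AnomalousDissipation.AnomalousDissipation.Theorems.SolenoidalFractalHomogenisationRealisedQuasiStaticCellLawWeakSlotFactor
import Summits.AnomalousDissipation.AnomalousDissipation.Theorems.SolenoidalFractalHomogenisationRealisedQuasiStaticCellLawInPlaneWeightLower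
import Summits.AnomalousDissipation.AnomalousDissipation.Theorems.SolenoidalFractalHomogenisationRealisedQuasiStaticCellLawRateChoice
import HarnessLib

/-!
# K2R `RealisedQuasiStaticCellLaw`, line `floquet-bloch`, stub `stub_lowSectorDecay` (S1D): decay of a WEAKLY coupled low
# sector at a target rate, modulo scalar inequalities (W-far road, all frames discharged)

Summits-side helper file (everything proved; no definitions, no named facts; `--supports stmt-AnomalousDissipation-20446`).
Weak-coupling counterpart of `lowSector_decay_of_rates` (g2, strong road): `weakSector_decay_ae` with the frames of
`anySlot_inputs` (every slot), the slaving weights bounded by `slaving_weight_bounds` / `outPlane_weight_ge_two` /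
`inPlane_weight_lower`, the slot factors bounded by `weak_slot_factor_le`, and the per-slot factors ALLOCATED proportionally
(`Θ_j = exp(−c·m_j/Σm)`, so that `∏Θ_j = e^{−c}` exactly — no large prefactor): for a sector `ℓ ≠ 0` with `4|ℓ| ≤ |K_j|` for
all slots, `2|ℓ| ≤ n`, weights `ε ∈ (0, 1/2]`, `β ≥ 1` with `βε·7/16 ≥ 2`, weak coupling `g₁,j² ≤ 1/64` and the two slack
conditions of `weak_slot_factor_le` in every slot, and a target `0 ≤ c ≤ Σ_j m_j`,
`m_j = min(8π²κ(n/2)²τ_j, 2Λ_jτ_j(d₀,j + (1−2ε)σ^fl_j g₁,j²(1−4ρ/3)))` with the frame-free in-plane floor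
`σ^fl_j = min(2, 2max(F_j,0)²/(1+2|ℓ·K_j|/|K_j|²))`: every weak solution from the sector satisfies
`∫‖w(t)‖² ≤ β·e^c·e^{−(c/P)t}·∫‖w₀‖²` a.e. (`weakSector_decay_of_rates`).
-/

set_option linter.dupNamespace false

noncomputable section

namespace Summit.AnomalousDissipation.AnomalousDissipation.Theorems.SolenoidalFractalHomogenisation.RealisedQuasiStaticCellLaw

open Set MeasureTheory Filter Topology Function Matrix
open scoped InnerProductSpace ComplexConjugate Matrix
open Literature.Analysis Literature.Analysis.FunctionSpaces Literature.Analysis.FunctionSpaces.Torus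
open Literature.Analysis.FluidPDE Literature.Analysis.FluidPDE.LatticeShear

variable {k₀ : ℕ}

/-- **Weak-sector decay at a target rate, modulo scalar inequalities.** -/
theorem weakSector_decay_of_rates (W : LatticeWord k₀) {n : ℕ} (hn : 0 < n) {κ : ℝ} (hκ : 0 < κ)
    (ℓ : Fin 3 → ℤ) (hℓ : ℓ ≠ 0) (hℓn : 2 * ‖latticeVec ℓ‖ ≤ n) {w₀ : UnitAddTorus (Fin 3) → EuclideanSpace ℝ (Fin 3)}
    (hw₀ : FunctionSpaces.Torus.MemSobolev 1 (FunctionSpaces.EuclideanSpace.complexify ∘ w₀))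
    (hdiv : FunctionSpaces.Torus.IsWeaklyDivFree w₀) (hmean : FunctionSpaces.Torus.HasZeroMean w₀)
    (hsupp : ∀ k : Fin 3 → ℤ, ¬ ((∃ z : Fin 3 → ℤ, k = ℓ + (n:ℤ) • z) ∨ (∃ z : Fin 3 → ℤ, k = -ℓ + (n:ℤ) • z)) →
      UnitAddTorus.mFourierCoeff (FunctionSpaces.EuclideanSpace.complexify ∘ w₀) k = 0)
    (h4 : ∀ j : Fin k₀, 4 * ‖latticeVec ℓ‖ ≤ ‖latticeVec (fun i => (W.phase j).m i * (n : ℤ))‖)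
    {ε β : ℝ} (hε : 0 < ε) (hε2 : ε ≤ 1 / 2) (hβ : 1 ≤ β) (hβ2 : 2 ≤ β * (7 / 16) * ε)
    (hga : ∀ j : Fin k₀, (2 * Real.pi * (∑ i, (W.phase j).e i * (ℓ i : ℝ)) * ‖Complex.exp ((W.phase j).φ * Complex.I) * (1 / (2 * ((2 * Real.pi * ‖latticeVec (W.phase j).m‖ : ℝ) : ℂ) * Complex.I))‖ * (1 / (n : ℝ)) / (κ * (4 * Real.pi ^ 2 * freqNormSq (fun i => (W.phase j).m i * (n : ℤ))))) ^ 2 ≤ 1 / 64)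
    (hS1 : ∀ j : Fin k₀, 80 * β * (2 * Real.pi * (∑ i, (W.phase j).e i * (ℓ i : ℝ)) * ‖Complex.exp ((W.phase j).φ * Complex.I) * (1 / (2 * ((2 * Real.pi * ‖latticeVec (W.phase j).m‖ : ℝ) : ℂ) * Complex.I))‖ * (1 / (n : ℝ)) / (κ * (4 * Real.pi ^ 2 * freqNormSq (fun i => (W.phase j).m i * (n : ℤ))))) ^ 2 * (1 + (2 * Real.pi * (∑ i, (W.phase j).e i * (ℓ i : ℝ)) * ‖Complex.exp ((W.phase j).φ * Complex.I) * (1 / (2 * ((2 * Real.pi * ‖latticeVec (W.phase j).m‖ : ℝ) : ℂ) * Complex.I))‖ * (1 / (n : ℝ)) / (κ * (4 * Real.pi ^ 2 * freqNormSq (fun i => (W.phase j).m i * (n : ℤ))))) ^ 2 * (32 / 7) ^ 2) ≤ ε * (7 / 16) ^ 3 * (1 - 4 * W.ramp / 3))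
    (hS2 : ∀ j : Fin k₀, 96 * β ≤ ε * W.ramp * (7 / 16) ^ 3 * (1 - 4 * W.ramp / 3) * ((κ * (4 * Real.pi ^ 2 * freqNormSq (fun i => (W.phase j).m i * (n : ℤ)))) * (W.phase j).τ) ^ 2)
    {c : ℝ} (hc0 : 0 ≤ c) (hc : c ≤ ∑ j : Fin k₀, (min (8 * Real.pi ^ 2 * κ * ((n : ℝ) / 2) ^ 2 * (W.phase j).τ) (2 * (κ * (4 * Real.pi ^ 2 * freqNormSq (fun i => (W.phase j).m i * (n : ℤ)))) * (W.phase j).τ * ((freqNormSq ℓ / freqNormSq (fun i => (W.phase j).m i * (n : ℤ))) + (1 - 2 * ε) * (min 2 (2 * (max ((|(fun i => ((ℓ i : ℤ) : ℝ)) ⬝ᵥ (fun i => (((fun i => (W.phase j).m i * (n : ℤ)) i : ℤ) : ℝ))| - (fun i => ((ℓ i : ℤ) : ℝ)) ⬝ᵥ (fun i => ((ℓ i : ℤ) : ℝ))) / (Real.sqrt ((fun i => ((ℓ i : ℤ) : ℝ)) ⬝ᵥ (fun i => ((ℓ i : ℤ) : ℝ))) * (Real.sqrt ((fun i => ((ℓ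 i : ℤ) : ℝ)) ⬝ᵥ (fun i => ((ℓ i : ℤ) : ℝ))) + Real.sqrt ((fun i => (((fun i => (W.phase j).m i * (n : ℤ)) i : ℤ) : ℝ)) ⬝ᵥ (fun i => (((fun i => (W.phase j).m i * (n : ℤ)) i : ℤ) : ℝ)))))) 0) ^ 2 / (1 + 2 * |(fun i => ((ℓ i : ℤ) : ℝ)) ⬝ᵥ (fun i => (((fun i => (W.phase j).m i * (n : ℤ)) i : ℤ) : ℝ))| / ((fun i => (((fun i => (W.phase j).m i * (n : ℤ)) i : ℤ) : ℝ)) ⬝ᵥ (fun i => (((fun i => (W.phase j).m i * (n : ℤ)) i : ℤ) : ℝ)))))) * ((2 * Real.pi * (∑ i, (W.phase j).e i * (ℓ i : ℝ)) * ‖Complex.exp ((W.phase j).φ * Complex.I) * (1 / (2 * ((2 * Real.pi * ‖latticeVec (W.phase j).m‖ : ℝ) : ℂ) * Complex.I))‖ * (1 / (n : ℝ)) / (κ * (4 * Real.pi ^ 2 * freqNormSq (fun i => (W.phase j).m i * (n : ℤ))))) ^ 2 * (1 - 4 * W.ramp / 3))))))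
    {T : ℝ} (hT : 0 < T) {w : ℝ → UnitAddTorus (Fin 3) → EuclideanSpace ℝ (Fin 3)}
    (hw : Torus.IsWeakPassiveVectorOn 0 T κ (W.cell n) w₀ w) :
    ∀ᵐ t ∂(volume.restrict (Ioo 0 T)), ∫ x, ‖w t x‖ ^ 2 ≤
      β * Real.exp c * Real.exp (-(c / W.period) * t) * ∫ x, ‖w₀ x‖ ^ 2 := by
  classical
  have hn' : (0 : ℝ) < n := by exact_mod_cast hn
  have hρ := W.ramp_pos
  have hρ2 := W.ramp_le
  have hr : 0 ≤ 1 - 4 * W.ramp / 3 := by linarith only [hρ2]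
  -- frames and gap data in every slot
  have hin := fun j : Fin k₀ => anySlot_inputs (W.phase j) hn hℓ (h4 j)
  choose ζr pf hk hdisj hζ1 hζ0 hζK hp hs hd0 hgap hd1 hdm1 using hin
  have hK0 : ∀ j : Fin k₀, (fun i => (W.phase j).m i * (n : ℤ)) ≠ 0 := fun j => cellFreq_ne_zero (W.phase j) hn
  have hKpos : ∀ j : Fin k₀, 0 < freqNormSq (fun i => (W.phase j).m i * (n : ℤ)) := fun j => by
    rw [← norm_latticeVec_sq]; have := one_le_norm_latticeVec (hK0 j); positivity
  have hℓpos : 0 < freqNormSq ℓ := by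
    rw [← norm_latticeVec_sq]; have := one_le_norm_latticeVec hℓ; positivity
  -- abbreviations
  obtain ⟨Lf, hLf⟩ : ∃ f : Fin k₀ → ℝ, f = fun j => (κ * (4 * Real.pi ^ 2 * freqNormSq (fun i => (W.phase j).m i * (n : ℤ)))) := ⟨_, rfl⟩
  have hLpos : ∀ j, 0 < Lf j := fun j => by rw [hLf]; have := hKpos j; positivity
  obtain ⟨Gf, hGf⟩ : ∃ f : Fin k₀ → ℝ, f = fun j => (2 * Real.pi * (∑ i, (W.phase j).e i * (ℓ i : ℝ)) * ‖Complex.exp ((W.phase j).φ * Complex.I) * (1 / (2 * ((2 * Real.pi * ‖latticeVec (W.phase j).m‖ : ℝ) : ℂ) * Complex.I))‖ * (1 / (n : ℝ)) / Lf j) := ⟨_, rfl⟩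
  have hGexp : ∀ j, Gf j = (2 * Real.pi * (∑ i, (W.phase j).e i * (ℓ i : ℝ)) * ‖Complex.exp ((W.phase j).φ * Complex.I) * (1 / (2 * ((2 * Real.pi * ‖latticeVec (W.phase j).m‖ : ℝ) : ℂ) * Complex.I))‖ * (1 / (n : ℝ)) / (κ * (4 * Real.pi ^ 2 * freqNormSq (fun i => (W.phase j).m i * (n : ℤ))))) := fun j => by rw [hGf, hLf]
  obtain ⟨D0f, hD0f⟩ : ∃ f : Fin k₀ → ℝ, f = fun j => (freqNormSq ℓ / freqNormSq (fun i => (W.phase j).m i * (n : ℤ))) := ⟨_, rfl⟩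
  obtain ⟨Dp, hDp⟩ : ∃ f : Fin k₀ → ℝ, f = fun j => (freqNormSq (ℓ + (1 : ℤ) • (fun i => (W.phase j).m i * (n : ℤ))) / freqNormSq (fun i => (W.phase j).m i * (n : ℤ))) := ⟨_, rfl⟩
  obtain ⟨Dm, hDm⟩ : ∃ f : Fin k₀ → ℝ, f = fun j => (freqNormSq (ℓ + (-1 : ℤ) • (fun i => (W.phase j).m i * (n : ℤ))) / freqNormSq (fun i => (W.phase j).m i * (n : ℤ))) := ⟨_, rfl⟩
  have eD0 : ∀ j, (freqNormSq ℓ / freqNormSq (fun i => (W.phase j).m i * (n : ℤ))) = D0f j := fun j => by rw [hD0f]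
  have eDp : ∀ j, (freqNormSq (ℓ + (1 : ℤ) • (fun i => (W.phase j).m i * (n : ℤ))) / freqNormSq (fun i => (W.phase j).m i * (n : ℤ))) = Dp j := fun j => by rw [hDp]
  have eDm : ∀ j, (freqNormSq (ℓ + (-1 : ℤ) • (fun i => (W.phase j).m i * (n : ℤ))) / freqNormSq (fun i => (W.phase j).m i * (n : ℤ))) = Dm j := fun j => by rw [hDm]
  have hd0nn : ∀ j, 0 ≤ D0f j := fun j => by rw [hD0f]; exact div_nonneg (freqNormSq_nonneg _) (hKpos j).le
  have hd0pos : ∀ j, 0 < D0f j := fun j => by rw [hD0f]; exact div_pos hℓpos (hKpos j)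
  have hgp' : ∀ j, D0f j + 7 / 16 ≤ Dp j := fun j => by rw [← eD0, ← eDp]; exact hgap j 1 one_ne_zero
  have hgm' : ∀ j, D0f j + 7 / 16 ≤ Dm j := fun j => by rw [← eD0, ← eDm]; exact hgap j (-1) (by norm_num)
  have hd1' : ∀ j, Dp j ≤ 2 := fun j => by rw [← eDp]; exact hd1 j
  have hdm1' : ∀ j, Dm j ≤ 2 := fun j => by rw [← eDm]; exact hdm1 j
  have hgp : ∀ j, 0 < Dp j - D0f j := fun j => by linarith only [hgp' j]
  have hgm : ∀ j, 0 < Dm j - D0f j := fun j => by linarith only [hgm' j]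
  obtain ⟨So, hSo⟩ : ∃ f : Fin k₀ → ℝ, f = fun j => 1 / (Dm j - D0f j) + 1 / (Dp j - D0f j) := ⟨_, rfl⟩
  obtain ⟨Si, hSi⟩ : ∃ f : Fin k₀ → ℝ, f = fun j =>
      (pf j (-1) ⬝ᵥ pf j 0) ^ 2 / (Dm j - D0f j) + (pf j 0 ⬝ᵥ pf j 1) ^ 2 / (Dp j - D0f j) := ⟨_, rfl⟩
  obtain ⟨Fl, hFl⟩ : ∃ f : Fin k₀ → ℝ, f = fun j => (min 2 (2 * (max ((|(fun i => ((ℓ i : ℤ) : ℝ)) ⬝ᵥ (fun i => (((fun i => (W.phase j).m i * (n : ℤ)) i : ℤ) : ℝ))| - (fun i => ((ℓ i : ℤ) : ℝ)) ⬝ᵥ (fun i => ((ℓ i : ℤ) : ℝ))) / (Real.sqrt ((fun i => ((ℓ i : ℤ) : ℝ)) ⬝ᵥ (fun i => ((ℓ i : ℤ) : ℝ))) * (Real.sqrt ((fun i => ((ℓ i : ℤ) : ℝ)) ⬝ᵥ (fun i => ((ℓ i : ℤ) : ℝ))) + Real.sqrt ((fun i => (((fun i => (W.phase j).m i * (n :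 ℤ)) i : ℤ) : ℝ)) ⬝ᵥ (fun i => (((fun i => (W.phase j).m i * (n : ℤ)) i : ℤ) : ℝ)))))) 0) ^ 2 / (1 + 2 * |(fun i => ((ℓ i : ℤ) : ℝ)) ⬝ᵥ (fun i => (((fun i => (W.phase j).m i * (n : ℤ)) i : ℤ) : ℝ))| / ((fun i => (((fun i => (W.phase j).m i * (n : ℤ)) i : ℤ) : ℝ)) ⬝ᵥ (fun i => (((fun i => (W.phase j).m i * (n : ℤ)) i : ℤ) : ℝ)))))) := ⟨_, rfl⟩
  obtain ⟨Mj, hMj⟩ : ∃ f : Fin k₀ → ℝ, f = fun j => min (8 * Real.pi ^ 2 * κ * ((n : ℝ) / 2) ^ 2 * (W.phase j).τ)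
      (2 * Lf j * (W.phase j).τ * (D0f j + (1 - 2 * ε) * Fl j * (Gf j ^ 2 * (1 - 4 * W.ramp / 3)))) := ⟨_, rfl⟩
  have eMj : ∀ j, (min (8 * Real.pi ^ 2 * κ * ((n : ℝ) / 2) ^ 2 * (W.phase j).τ) (2 * (κ * (4 * Real.pi ^ 2 * freqNormSq (fun i => (W.phase j).m i * (n : ℤ)))) * (W.phase j).τ * ((freqNormSq ℓ / freqNormSq (fun i => (W.phase j).m i * (n : ℤ))) + (1 - 2 * ε) * (min 2 (2 * (max ((|(fun i => ((ℓ i : ℤ) : ℝ)) ⬝ᵥ (fun i => (((fun i => (W.phase j).m i * (n : ℤ)) i : ℤ) : ℝ))| - (fun i => ((ℓ i : ℤ) : ℝ)) ⬝ᵥ (fun i => ((ℓ i : ℤ) : ℝ))) / (Real.sqrt ((fun i => ((ℓ i : ℤ) : ℝ)) ⬝ᵥ (fun i => ((ℓ i : ℤ) : ℝ))) * (Real.sqrt ((fun i => ((ℓ i : ℤ) : ℝ)) ⬝ᵥ (fun i => ((ℓ i : ℤ) : ℝ))) + Real.sqrt ((fun i => (((fun i => (W.phase j).m i * (n : ℤ))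 i : ℤ) : ℝ)) ⬝ᵥ (fun i => (((fun i => (W.phase j).m i * (n : ℤ)) i : ℤ) : ℝ)))))) 0) ^ 2 / (1 + 2 * |(fun i => ((ℓ i : ℤ) : ℝ)) ⬝ᵥ (fun i => (((fun i => (W.phase j).m i * (n : ℤ)) i : ℤ) : ℝ))| / ((fun i => (((fun i => (W.phase j).m i * (n : ℤ)) i : ℤ) : ℝ)) ⬝ᵥ (fun i => (((fun i => (W.phase j).m i * (n : ℤ)) i : ℤ) : ℝ)))))) * ((2 * Real.pi * (∑ i, (W.phase j).e i * (ℓ i : ℝ)) * ‖Complex.exp ((W.phase j).φ * Complex.I) * (1 / (2 * ((2 * Real.pi * ‖latticeVec (W.phase j).m‖ : ℝ) : ℂ) * Complex.I))‖ * (1 / (n : ℝ)) / (κ * (4 * Real.pi ^ 2 * freqNormSq (fun i => (W.phase j).m i * (n : ℤ))))) ^ 2 * (1 - 4 * W.ramp / 3))))) = Mj j := fun j => by rw [hMj, hGf, hFl, hD0f, hLf]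
  -- the slaving weights
  have hwb : ∀ j, 1 ≤ So j ∧ So j ≤ 32 / 7 ∧ ((pf j 0 ⬝ᵥ pf j 1) ^ 2 + (pf j (-1) ⬝ᵥ pf j 0) ^ 2) / 2 ≤ Si j ∧
      Si j ≤ 16 / 7 * ((pf j 0 ⬝ᵥ pf j 1) ^ 2 + (pf j (-1) ⬝ᵥ pf j 0) ^ 2) ∧
      (pf j 0 ⬝ᵥ pf j 1) ^ 2 + (pf j (-1) ⬝ᵥ pf j 0) ^ 2 ≤ 2 ∧ Si j ≤ 32 / 7 := by
    intro j
    have h := slaving_weight_bounds (s0 := pf j 0 ⬝ᵥ pf j 1) (sm1 := pf j (-1) ⬝ᵥ pf j 0) (hd0nn j) (hgp' j) (hgm' j)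
      (hd1' j) (hdm1' j) (hs j 0) (by have := hs j (-1); rwa [show (-1 : ℤ) + 1 = 0 by norm_num] at this)
    rw [hSo, hSi]
    exact h
  have hσo2 : ∀ j, 2 ≤ So j := fun j => by
    have h := outPlane_weight_ge_two ℓ (fun i => (W.phase j).m i * (n : ℤ)) (hK0 j) (by rw [eDp, eD0]; exact hgp j) (by rw [eDm, eD0]; exact hgm j)
    rw [eDp, eDm, eD0] at h
    rw [hSo]; exact h
  have hσifl : ∀ j, Fl j ≤ Si j := fun j => by
    have h := inPlane_weight_lower ℓ (fun i => (W.phase j).m i * (n : ℤ)) hℓ (hK0 j) (hζ1 j) (hζ0 j) (hζK j) (hp j)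
      (by rw [eDp, eD0]; exact hgp j) (by rw [eDm, eD0]; exact hgm j)
    rw [eDp, eDm, eD0] at h
    rw [hFl, hSi]
    exact (min_le_right _ _).trans h
  have hFl2 : ∀ j, Fl j ≤ 2 := fun j => by rw [hFl]; exact min_le_left _ _
  have hFl0 : ∀ j, 0 ≤ Fl j := fun j => by
    rw [hFl]
    refine le_min (by norm_num) (div_nonneg (mul_nonneg (by norm_num) (sq_nonneg _)) ?_)
    have : 0 < (fun i => (((fun i => (W.phase j).m i * (n : ℤ)) i : ℤ) : ℝ)) ⬝ᵥ (fun i => (((fun i => (W.phase j).m i * (n : ℤ)) i : ℤ) : ℝ)) := by rw [← freqNormSq_eq_dotProduct]; exact hKpos j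
    positivity
  -- converted smallness hypotheses
  have hga' : ∀ j, Gf j ^ 2 ≤ 1 / 64 := fun j => by rw [hGexp]; exact hga j
  have hS1' : ∀ j, 80 * β * Gf j ^ 2 * (1 + Gf j ^ 2 * (32 / 7) ^ 2) ≤ ε * (7 / 16) ^ 3 * (1 - 4 * W.ramp / 3) :=
    fun j => by rw [hGexp]; exact hS1 j
  have hS2' : ∀ j, 96 * β ≤ ε * W.ramp * (7 / 16) ^ 3 * (1 - 4 * W.ramp / 3) * (Lf j * (W.phase j).τ) ^ 2 :=
    fun j => by rw [hLf]; exact hS2 j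
  -- the target allocation
  have hmpos : ∀ j, 0 < Mj j := by
    intro j
    rw [hMj]
    have hτ := (W.phase j).τ_pos
    refine lt_min (by positivity) ?_
    have h1 : 0 ≤ (1 - 2 * ε) * Fl j * (Gf j ^ 2 * (1 - 4 * W.ramp / 3)) :=
      mul_nonneg (mul_nonneg (by linarith only [hε2]) (hFl0 j)) (mul_nonneg (sq_nonneg _) hr)
    have h2 : 0 < 2 * Lf j * (W.phase j).τ := by have := hLpos j; positivity
    have h3 : 0 < D0f j + (1 - 2 * ε) * Fl j * (Gf j ^ 2 * (1 - 4 * W.ramp / 3)) := by linarith only [hd0pos j, h1]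
    exact mul_pos h2 h3
  obtain ⟨Mtot, hMtot⟩ : ∃ M : ℝ, M = ∑ j : Fin k₀, Mj j := ⟨_, rfl⟩
  have hc' : c ≤ Mtot := by
    rw [hMtot]; exact hc.trans (le_of_eq (Finset.sum_congr rfl fun j _ => eMj j))
  have hM : 0 < Mtot := by
    rw [hMtot]
    have : Nonempty (Fin k₀) := ⟨⟨0, W.pos⟩⟩
    exact Finset.sum_pos (fun j _ => hmpos j) Finset.univ_nonempty
  obtain ⟨Θ, hΘ⟩ : ∃ Θ : Fin k₀ → ℝ, Θ = fun j => Real.exp (-(c / Mtot * Mj j)) := ⟨_, rfl⟩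
  have hcM : c / Mtot ≤ 1 := (div_le_one hM).2 hc'
  have hsumM : ∑ j : Fin k₀, c / Mtot * Mj j = c := by
    rw [← Finset.mul_sum, ← hMtot]; field_simp
  have hΘprod : ∏ j, Θ j = Real.exp (-c) := by
    rw [hΘ]
    simp only []
    rw [← Real.exp_sum, Finset.sum_neg_distrib, hsumM]
  -- per-slot hypotheses of the weak road
  have hβo : ∀ j, 2 ≤ β * (7 / 16) * ε * So j := by
    intro j
    have h1 := (hwb j).1
    have h0 : 0 ≤ β * (7 / 16) * ε - 2 := by linarith only [hβ2]
    nlinarith only [h1, h0, mul_nonneg h0 (sub_nonneg.2 h1)]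
  have hsmallo : ∀ j, Gf j ^ 2 * (4 * 2 / (7 / 16) + 2 * So j) ≤ 7 / 16 := by
    intro j
    have h1 := (hwb j).2.1
    have hg := hga' j
    have hg0 : 0 ≤ Gf j ^ 2 := sq_nonneg _
    have hb : 4 * 2 / (7 / 16) + 2 * So j ≤ 192 / 7 := by linarith only [h1]
    have := mul_le_mul hg hb (by linarith only [(hwb j).1]) (by norm_num)
    linarith only [this]
  have hβi : ∀ j, (pf j 0 ⬝ᵥ pf j 1) ^ 2 + (pf j (-1) ⬝ᵥ pf j 0) ^ 2 ≤ β * (7 / 16) * ε * Si j := by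
    intro j
    have h1 := (hwb j).2.2.1
    have hσ0 : 0 ≤ Si j := le_trans (by positivity) h1
    linarith only [h1, mul_le_mul_of_nonneg_right hβ2 hσ0]
  have hsmalli : ∀ j, Gf j ^ 2 * (4 * ((pf j 0 ⬝ᵥ pf j 1) ^ 2 + (pf j (-1) ⬝ᵥ pf j 0) ^ 2) / (7 / 16) + 2 * Si j) ≤
      7 / 16 := by
    intro j
    have h1 := (hwb j).2.2.2.2.1
    have h2 := (hwb j).2.2.2.2.2
    have hg := hga' j
    have hg0 : 0 ≤ Gf j ^ 2 := sq_nonneg _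
    have hγ0 : 0 ≤ (pf j 0 ⬝ᵥ pf j 1) ^ 2 + (pf j (-1) ⬝ᵥ pf j 0) ^ 2 := by positivity
    have hσi0 : 0 ≤ Si j := le_trans (by positivity) (hwb j).2.2.1
    have hb : 4 * ((pf j 0 ⬝ᵥ pf j 1) ^ 2 + (pf j (-1) ⬝ᵥ pf j 0) ^ 2) / (7 / 16) + 2 * Si j ≤ 192 / 7 := by
      have : 4 * ((pf j 0 ⬝ᵥ pf j 1) ^ 2 + (pf j (-1) ⬝ᵥ pf j 0) ^ 2) / (7 / 16) ≤ 128 / 7 := by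
        rw [div_le_iff₀ (by norm_num : (0:ℝ) < 7 / 16)]; linarith only [h1]
      linarith only [this, h2]
    have hb0 : 0 ≤ 4 * ((pf j 0 ⬝ᵥ pf j 1) ^ 2 + (pf j (-1) ⬝ᵥ pf j 0) ^ 2) / (7 / 16) + 2 * Si j :=
      add_nonneg (by positivity) (by linarith only [hσi0])
    have := mul_le_mul hg hb hb0 (by norm_num)
    linarith only [this]
  -- the slot factors are below the allocated `Θ_j`
  have hmono : ∀ j, ∀ σ : ℝ, Fl j ≤ σ →
      Real.exp (-(2 * Lf j * (W.phase j).τ * (D0f j + (1 - 2 * ε) * σ * (Gf j ^ 2 * (1 - 4 * W.ramp / 3))))) ≤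
        Real.exp (-(Mj j)) := by
    intro j σ hσ
    rw [hMj]
    refine Real.exp_le_exp.2 (neg_le_neg ((min_le_right _ _).trans ?_))
    have hT : 0 ≤ 2 * Lf j * (W.phase j).τ := by have := (W.phase j).τ_pos; have := hLpos j; positivity
    refine mul_le_mul_of_nonneg_left (add_le_add le_rfl ?_) hT
    exact mul_le_mul_of_nonneg_right (mul_le_mul_of_nonneg_left hσ (by linarith only [hε2])) (mul_nonneg (sq_nonneg _) hr)
  have hMJΘ : ∀ j, Real.exp (-(Mj j)) ≤ Θ j := by
    intro j
    rw [hΘ]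
    refine Real.exp_le_exp.2 (neg_le_neg ?_)
    exact mul_le_of_le_one_left (hmpos j).le hcM
  have hΘle : ∀ j, max (Real.exp (-(8 * Real.pi ^ 2 * κ * ((n : ℝ) / 2) ^ 2) * (W.phase j).τ))
      (max (Real.exp (-(2 * Lf j * (W.phase j).τ * (freqNormSq ℓ / freqNormSq (fun i => (W.phase j).m i * (n : ℤ)) +
              (1 - ε) * So j * (Gf j ^ 2 * (1 - 4 * W.ramp / 3)))) +
            40 * β * 2 * Lf j * (W.phase j).τ * Gf j ^ 4 * (1 + Gf j ^ 2 * So j ^ 2) / (7 / 16) ^ 3 +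
            48 * β * 2 * Gf j ^ 2 / (W.ramp * (W.phase j).τ * Lf j * (7 / 16) ^ 3)))
          (Real.exp (-(2 * Lf j * (W.phase j).τ * (freqNormSq ℓ / freqNormSq (fun i => (W.phase j).m i * (n : ℤ)) +
              (1 - ε) * Si j * (Gf j ^ 2 * (1 - 4 * W.ramp / 3)))) +
            40 * β * ((pf j 0 ⬝ᵥ pf j 1) ^ 2 + (pf j (-1) ⬝ᵥ pf j 0) ^ 2) * Lf j * (W.phase j).τ * Gf j ^ 4 *
              (1 + Gf j ^ 2 * Si j ^ 2) / (7 / 16) ^ 3 +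
            48 * β * ((pf j 0 ⬝ᵥ pf j 1) ^ 2 + (pf j (-1) ⬝ᵥ pf j 0) ^ 2) * Gf j ^ 2 /
              (W.ramp * (W.phase j).τ * Lf j * (7 / 16) ^ 3)))) ≤ Θ j := by
    intro j
    have hτ := (W.phase j).τ_pos
    rw [eD0]
    refine max_le ?_ (max_le ?_ ?_)
    · refine le_trans (Real.exp_le_exp.2 ?_) (hMJΘ j)
      rw [hMj, neg_mul]
      exact neg_le_neg (min_le_left _ _)
    · have h := (weak_slot_factor_le (d0 := D0f j) (ε := ε) (σ := So j) (σ' := So j) (σmax := 32 / 7)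
        (g₁ := Gf j) (γ2 := 2) (β := β) (hLpos j) hτ (hd0nn j) (zero_le_one.trans (hwb j).1) (zero_le_one.trans (hwb j).1)
        (hwb j).2.1 (by linarith only [(hwb j).1]) (zero_le_one.trans hβ) hρ hρ2 (by norm_num : (0:ℝ) < 7 / 16) (hS1' j) (hS2' j)).1
      exact h.trans ((hmono j _ ((hFl2 j).trans (hσo2 j))).trans (hMJΘ j))
    · have hσi0 : 0 ≤ Si j := le_trans (by positivity) (hwb j).2.2.1
      have hγ2 : (pf j 0 ⬝ᵥ pf j 1) ^ 2 + (pf j (-1) ⬝ᵥ pf j 0) ^ 2 ≤ 2 * Si j := by linarith only [(hwb j).2.2.1]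
      have h := (weak_slot_factor_le (d0 := D0f j) (ε := ε) (σ := Si j) (σ' := Si j) (σmax := 32 / 7)
        (g₁ := Gf j) (γ2 := (pf j 0 ⬝ᵥ pf j 1) ^ 2 + (pf j (-1) ⬝ᵥ pf j 0) ^ 2) (β := β) (hLpos j) hτ (hd0nn j)
        hσi0 hσi0 (hwb j).2.2.2.2.2 hγ2 (zero_le_one.trans hβ) hρ hρ2 (by norm_num : (0:ℝ) < 7 / 16) (hS1' j) (hS2' j)).1
      exact h.trans ((hmono j _ (hσifl j)).trans (hMJΘ j))
  have hΘ1 : ∏ j, Θ j ≤ 1 := by rw [hΘprod]; exact Real.exp_le_one_iff.2 (neg_nonpos.2 hc0)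
  have hΘ0 : 0 < ∏ j, Θ j := by rw [hΘprod]; exact Real.exp_pos _
  have hdec := weakSector_decay_ae W hn hκ ℓ hℓn hw₀ hdiv hmean hsupp hk hdisj ζr hζ1 hζ0 hζK pf hp hs
    Lf So Si Gf Θ (7 / 16) ε β
    (fun j => by rw [hLf]) (by norm_num) hε.le hβ hgap
    (fun j => by rw [hSo, eDm, eDp, eD0]) (fun j => by rw [hSi, eDm, eDp, eD0]) (fun j => by rw [hGf])
    hβo hsmallo hβi hsmalli hΘle hΘ1 hΘ0 hT hw
  rw [hΘprod, log_inv_exp_neg, inv_exp_neg] at hdec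
  exact hdec

end Summit.AnomalousDissipation.AnomalousDissipation.Theorems.SolenoidalFractalHomogenisation.RealisedQuasiStaticCellLaw

end
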